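import Mathlib
import Literature.NumberTheory.ModularForms.LevelThreeForms
import Literature.NumberTheory.ModularForms.LevelThreeEisensteinZeros
import Literature.NumberTheory.ModularForms.LevelThreeEtaQuotient
import Literature.NumberTheory.EllipticCurves.ModularCurveSturmProofs
import HarnessLib

/-!
# Identities between the level-`3` forms `𝓟`, `Δ₃`, `t`, `E₄`, `E₄(3τ)` by the norm to level one

[topic NumberTheory/ModularForms]

Support for the level-3 case of Zhou 2015, Remark 9. We prove identities in the ring generated by
`𝓟 = (3E₂(3τ) − E₂(τ))/2` (`eisThree`), `Δ₃ = (η(τ)η(3τ))⁶` (`deltaThree`), the eta quotient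
`t = (η(τ)/η(3τ))¹²` (`tThree`), `E₄` and `E₄(3τ)`, WITHOUT a Sturm bound on `Γ₀(3)`: a
holomorphic `Γ₀(3)`-covariant `W₃`-eigenfunction `F` of weight `k` (`F(−1/(3τ)) = wτᵏF(τ)`,
`w² = 3ᵏ`) has the **norm** `N(τ) = F(τ)F(τ/3)F((τ+1)/3)F((τ+2)/3)`, a level-one modular form
of weight `4k` (`normFour_form`); if `F` decays like `e^{−2πa Im τ}` with `2a > ⌊4k/12⌋`, then
`N = 0` by the level-one Sturm criterion of the tree (`levelOne_eq_zero_of_isBigO`), hence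
`F = 0` (`eq_zero_of_eigen_decay`). Decay is obtained from limits at `i∞` alone
(`UpperHalfPlane.IsZeroAtImInfty.exp_decay_atImInfty`). Applications:

* **`10𝓟² = E₄ + 9E₄(3τ)`** (`ten_eisThree_sq`);
* **`E₄·(t + 27) = 𝓟²(t + 243)`** and **`E₄(3τ)(t + 27) = 𝓟²(t + 3)`** (`E₄_mul_tThree_add`,
  through the weight-8 eigenfunction `X²/t`, `X = E₄(t+27) − 𝓟²(t+243)`, using the `q`-expansions
  of `E₂`, `E₄` to first order);
* **`𝓟³·t = Δ₃·(t + 27)²`** (`eisThree_cube_mul_tThree`), from the previous identity by a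
  Wronskian computation (`D log(𝓟³t/(Δ₃(t+27)²)) = X/(4𝓟(t+27)) = 0`) and the identity theorem.

## References
* Zhou 2015, Remark 9 (`(P_nu_sqr_E2_diff)`, level `3`). [cite: Zhou2015, Remark 9]
* the norm map to level one; Ramanujan's cubic theory. [folklore]
-/

noncomputable section

open Complex hiding I
open UpperHalfPlane hiding I
open Filter Topology ModularForm EisensteinSeries Real Asymptotics
open scoped MatrixGroups ModularForm Manifold

namespace Literature.NumberTheory.ModularForms

open Literature.NumberTheory.EllipticCurves.ModularForms (E₄_eq_zero_iff levelOne_apply_smul tendsto_E4_atImInfty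
  mulThree coe_mulThree mulThree_smul sl2zMk coe_sl2zMk_smul levelOne_eq_zero_of_isBigO)

/-! ## 1. The norm of a `Γ₀(3)`-covariant `W₃`-eigenfunction -/

section NormTool

variable {F : ℍ → ℂ} {k : ℕ} {w : ℂ}

/-- The norm `N(τ) := F(τ)F(τ/3)F((τ+1)/3)F((τ+2)/3)`. [folklore] -/
def normFour (F : ℍ → ℂ) (τ : ℍ) : ℂ := F τ * (F (thirdPt 0 τ) * F (thirdPt 1 τ) * F (thirdPt 2 τ))

/-- `N(τ + 1) = N(τ)` when `F(τ + 1) = F(τ)`. [folklore] -/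
theorem normFour_vadd_one (hT : ∀ τ : ℍ, F ((1 : ℝ) +ᵥ τ) = F τ) (τ : ℍ) :
    normFour F ((1 : ℝ) +ᵥ τ) = normFour F τ := by
  rw [normFour, normFour, hT, thirdPt_vadd_one, thirdPt_vadd_one, thirdPt_vadd_one,
    show (0 : ℤ) + 1 = 1 by norm_num, show (1 : ℤ) + 1 = 2 by norm_num, show (2 : ℤ) + 1 = 3 by norm_num,
    thirdPt_three, hT]
  ring

/-- **`N(−1/τ) = τ^{4k}N(τ)`** for a `Γ₀(3)`-covariant `W₃`-eigenfunction with `w² = 3ᵏ`. [folklore] -/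
theorem normFour_S_smul
    (hg1 : ∀ τ : ℍ, F (gOne • τ) = (3 * (τ : ℂ) - 2) ^ k * F τ) (hg2 : ∀ τ : ℍ, F (gTwo • τ) = (3 * (τ : ℂ) - 1) ^ k * F τ)
    (hW : ∀ τ : ℍ, F (frickeThree τ) = w * (τ : ℂ) ^ k * F τ) (hw : w ^ 2 = 3 ^ k) (τ : ℍ) :
    normFour F (ModularGroup.S • τ) = (τ : ℂ) ^ (4 * k) * normFour F τ := by
  rw [normFour, normFour, thirdPt_zero_S_smul, thirdPt_one_S_smul, thirdPt_two_S_smul, S_smul_eq_frickeThree_thirdPt,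
    hW, hW, hg1, hg2, coe_thirdPt, coe_thirdPt, coe_thirdPt]
  push_cast
  rw [show (3 : ℂ) * (((τ : ℂ) + 2) / 3) - 2 = τ by ring, show (3 : ℂ) * (((τ : ℂ) + 1) / 3) - 1 = τ by ring]
  have h3 : (3 : ℂ) ^ k ≠ 0 := pow_ne_zero _ three_ne_zero
  have e : (((τ : ℂ) + 0) / 3) ^ k = (τ : ℂ) ^ k / 3 ^ k := by rw [add_zero, div_pow]
  rw [e]
  field_simp
  rw [show (τ : ℂ) ^ (4 * k) = ((τ : ℂ) ^ k) ^ 4 by rw [← pow_mul, mul_comm]]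
  linear_combination (F τ * F (thirdPt 0 τ) * F (thirdPt 1 τ) * F (thirdPt 2 τ) * ((τ : ℂ) ^ k) ^ 4) * hw

/-- `F ∘ thirdPt j ∘ ofComplex` is differentiable when `F` is. [folklore] -/
theorem differentiableAt_comp_thirdPt (hmd : MDiff F) (j : ℤ) {w : ℂ} (hw : 0 < w.im) :
    DifferentiableAt ℂ (fun u : ℂ => F (thirdPt j (ofComplex u))) w := by
  have hw' : 0 < ((w + j) / 3).im := by rw [Complex.div_ofNat_im]; simpa using hw
  have hF : DifferentiableAt ℂ (F ∘ ofComplex) ((w + j) / 3) :=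
    (UpperHalfPlane.mdifferentiable_iff.mp hmd).differentiableAt (isOpen_upperHalfPlaneSet.mem_nhds hw')
  have h : DifferentiableAt ℂ ((F ∘ ofComplex) ∘ fun u : ℂ => (u + j) / 3) w := hF.comp w (by fun_prop)
  refine h.congr_of_eventuallyEq ?_
  filter_upwards [isOpen_upperHalfPlaneSet.mem_nhds hw] with u hu
  simp only [Function.comp_apply, thirdPt_ofComplex j hu]

/-- **`N` is holomorphic** when `F` is. [folklore] -/
theorem mdifferentiable_normFour (hmd : MDiff F) : MDiff (normFour F) := by
  rw [UpperHalfPlane.mdifferentiable_iff]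
  intro w hw
  have h0 : DifferentiableAt ℂ (F ∘ ofComplex) w :=
    (UpperHalfPlane.mdifferentiable_iff.mp hmd).differentiableAt (isOpen_upperHalfPlaneSet.mem_nhds hw)
  have h := h0.mul (((differentiableAt_comp_thirdPt hmd 0 hw).mul (differentiableAt_comp_thirdPt hmd 1 hw)).mul
    (differentiableAt_comp_thirdPt hmd 2 hw))
  refine (h.congr_of_eventuallyEq ?_).differentiableWithinAt
  filter_upwards [isOpen_upperHalfPlaneSet.mem_nhds hw] with u hu
  simp only [Function.comp_apply, normFour, Pi.mul_apply]

/-- **Decay of the norm**: `F = O(e^{−2πa Im τ})` gives `N = O(e^{−2π·2a·Im τ})`. [folklore] -/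
theorem normFour_isBigO {a : ℝ} (hdecay : F =O[atImInfty] fun τ : ℍ => Real.exp (-2 * π * a * τ.im)) :
    normFour F =O[atImInfty] fun τ : ℍ => Real.exp (-2 * π * (2 * a) * τ.im) := by
  have hj : ∀ j : ℤ, (fun τ : ℍ => F (thirdPt j τ)) =O[atImInfty] fun τ : ℍ => Real.exp (-2 * π * (a / 3) * τ.im) := by
    intro j
    have h := hdecay.comp_tendsto (tendsto_thirdPt_atImInfty j)
    refine h.congr_right fun τ => ?_
    simp only [Function.comp_apply, thirdPt_im]; ring_nf
  have h := hdecay.mul (((hj 0).mul (hj 1)).mul (hj 2))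
  refine (h.congr_left fun τ => rfl).congr_right fun τ => ?_
  rw [← Real.exp_add, ← Real.exp_add, ← Real.exp_add]
  ring_nf

/-- `N |_{4k} S = N`, `N |_{4k} T = N`. [folklore] -/
theorem normFour_slash_S_T (hT : ∀ τ : ℍ, F ((1 : ℝ) +ᵥ τ) = F τ)
    (hg1 : ∀ τ : ℍ, F (gOne • τ) = (3 * (τ : ℂ) - 2) ^ k * F τ) (hg2 : ∀ τ : ℍ, F (gTwo • τ) = (3 * (τ : ℂ) - 1) ^ k * F τ)
    (hW : ∀ τ : ℍ, F (frickeThree τ) = w * (τ : ℂ) ^ k * F τ) (hw : w ^ 2 = 3 ^ k) :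
    normFour F ∣[((4 * k : ℕ) : ℤ)] ModularGroup.S = normFour F ∧ normFour F ∣[((4 * k : ℕ) : ℤ)] ModularGroup.T = normFour F := by
  constructor
  · funext τ
    rw [SL_slash_apply, ModularGroup.denom_S, normFour_S_smul hg1 hg2 hW hw, zpow_neg, zpow_natCast]
    have hτ : (τ : ℂ) ≠ 0 := τ.ne_zero
    field_simp
  · funext τ
    rw [SL_slash_apply, UpperHalfPlane.modular_T_smul, normFour_vadd_one hT, ModularGroup.denom_apply]
    simp [ModularGroup.T]

/-- **`N` as a level-one modular form of weight `4k`.** [folklore] -/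
def normFourForm (hmd : MDiff F) (hT : ∀ τ : ℍ, F ((1 : ℝ) +ᵥ τ) = F τ)
    (hg1 : ∀ τ : ℍ, F (gOne • τ) = (3 * (τ : ℂ) - 2) ^ k * F τ) (hg2 : ∀ τ : ℍ, F (gTwo • τ) = (3 * (τ : ℂ) - 1) ^ k * F τ)
    (hW : ∀ τ : ℍ, F (frickeThree τ) = w * (τ : ℂ) ^ k * F τ) (hw : w ^ 2 = 3 ^ k)
    (hbdd : IsBoundedAtImInfty (normFour F)) : ModularForm 𝒮ℒ ((4 * k : ℕ) : ℤ) where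
  toFun := normFour F
  slash_action_eq' := by
    intro A hA
    obtain ⟨γ, rfl⟩ := hA
    exact SlashInvariantForm.slash_action_generators_SL2Z (normFour_slash_S_T hT hg1 hg2 hW hw).1
      (normFour_slash_S_T hT hg1 hg2 hW hw).2 γ
  holo' := mdifferentiable_normFour hmd
  bdd_at_cusps' hc := by
    rw [OnePoint.isBoundedAt_iff_forall_SL2Z hc]
    intro γ _
    have h : normFour F ∣[((4 * k : ℕ) : ℤ)] (γ : GL (Fin 2) ℝ) = normFour F := by
      have := SlashInvariantForm.slash_action_generators_SL2Z (normFour_slash_S_T hT hg1 hg2 hW hw).1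
        (normFour_slash_S_T hT hg1 hg2 hW hw).2 γ
      simpa [SL_slash] using this
    show IsBoundedAtImInfty (normFour F ∣[((4 * k : ℕ) : ℤ)] (γ : GL (Fin 2) ℝ))
    rw [h]
    exact hbdd

/-- Surjectivity of `thirdPt j ∘ ofComplex` onto `ℍ`. [folklore] -/
theorem thirdPt_ofComplex_surj (j : ℤ) (τ : ℍ) : ∃ u : ℂ, 0 < u.im ∧ thirdPt j (ofComplex u) = τ := by
  refine ⟨3 * (τ : ℂ) - j, by simpa using τ.im_pos, ?_⟩
  apply UpperHalfPlane.ext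
  rw [coe_thirdPt, ofComplex_apply_of_im_pos (by simpa using τ.im_pos)]
  ring

/-- **Vanishing criterion**: a holomorphic, `1`-periodic, `Γ₀(3)`-covariant `W₃`-eigenfunction of
weight `k` (`w² = 3ᵏ`) decaying like `e^{−2πa Im τ}` with `⌊4k/12⌋ < 2a` vanishes identically. [folklore] -/
theorem eq_zero_of_eigen_decay (hmd : MDiff F) (hT : ∀ τ : ℍ, F ((1 : ℝ) +ᵥ τ) = F τ)
    (hg1 : ∀ τ : ℍ, F (gOne • τ) = (3 * (τ : ℂ) - 2) ^ k * F τ) (hg2 : ∀ τ : ℍ, F (gTwo • τ) = (3 * (τ : ℂ) - 1) ^ k * F τ)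
    (hW : ∀ τ : ℍ, F (frickeThree τ) = w * (τ : ℂ) ^ k * F τ) (hw : w ^ 2 = 3 ^ k)
    {a : ℝ} (ha : 0 ≤ a) (hdecay : F =O[atImInfty] fun τ : ℍ => Real.exp (-2 * π * a * τ.im))
    (hka : (((4 * k : ℕ) / 12 : ℕ) : ℝ) < 2 * a) : ∀ τ : ℍ, F τ = 0 := by
  have hN := normFour_isBigO hdecay
  -- boundedness of the norm from its decay
  have hbdd : IsBoundedAtImInfty (normFour F) := by
    refine hN.trans (Asymptotics.IsBigO.of_bound 1 ?_)
    filter_upwards with τ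
    rw [Real.norm_eq_abs, abs_of_pos (Real.exp_pos _), Pi.one_apply, norm_one, one_mul, Real.exp_le_one_iff]
    nlinarith [mul_nonneg (mul_nonneg Real.pi_pos.le ha) τ.im_pos.le]
  set NF := normFourForm hmd hT hg1 hg2 hW hw hbdd with hNF
  have hcoe : (NF : ℍ → ℂ) = normFour F := rfl
  have hzero : NF = 0 := by
    apply levelOne_eq_zero_of_isBigO NF (M := 2 * a) (by rw [hcoe]; exact hN)
    have h4' : ((((4 * k : ℕ) : ℤ)).toNat / 12 : ℕ) = ((4 * k : ℕ) / 12 : ℕ) := by rw [Int.toNat_natCast]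
    rw [h4']; exact hka
  have hN0 : ∀ τ : ℍ, normFour F τ = 0 := fun τ => by
    have := congrFun (congrArg DFunLike.coe hzero) τ
    rw [hcoe] at this
    rw [this]
    rfl
  -- product of analytic functions on the (connected) upper half-plane
  set U : Set ℂ := {u : ℂ | 0 < u.im} with hU
  have hUo : IsOpen U := isOpen_upperHalfPlaneSet
  have hUc : IsPreconnected U := (convex_halfSpace_im_gt 0).isPreconnected
  have han : ∀ j : ℤ, AnalyticOnNhd ℂ (fun u : ℂ => F (thirdPt j (ofComplex u))) U := fun j => by
    have hd : DifferentiableOn ℂ (fun u : ℂ => F (thirdPt j (ofComplex u))) U := fun u hu =>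
      (differentiableAt_comp_thirdPt hmd j hu).differentiableWithinAt
    exact hd.analyticOnNhd hUo
  have han0 : AnalyticOnNhd ℂ (F ∘ ofComplex) U :=
    (UpperHalfPlane.mdifferentiable_iff.mp hmd).analyticOnNhd hUo
  have hprod : ∀ u ∈ U, (F ∘ ofComplex) u * (F (thirdPt 0 (ofComplex u)) * (F (thirdPt 1 (ofComplex u)) *
      F (thirdPt 2 (ofComplex u)))) = 0 := fun u hu => by
    have := hN0 (ofComplex u)
    rw [normFour] at this
    simp only [Function.comp_apply]
    linear_combination this
  -- one factor vanishes identically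
  have hconc : ∀ G : ℂ → ℂ, (∀ u ∈ U, G u = 0) → (∀ τ : ℍ, ∃ u ∈ U, G u = F τ) → ∀ τ : ℍ, F τ = 0 := by
    intro G hG hsurj τ
    obtain ⟨u, hu, hGu⟩ := hsurj τ
    rw [← hGu, hG u hu]
  have han012 : AnalyticOnNhd ℂ (fun u : ℂ => F (thirdPt 0 (ofComplex u)) * (F (thirdPt 1 (ofComplex u)) *
      F (thirdPt 2 (ofComplex u)))) U := (han 0).mul ((han 1).mul (han 2))
  rcases AnalyticOnNhd.eq_zero_or_eq_zero_of_mul_eq_zero han0 han012 hprod hUc with h | h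
  · exact hconc _ h fun τ => ⟨(τ : ℂ), τ.im_pos, by simp [ofComplex_apply]⟩
  · rcases AnalyticOnNhd.eq_zero_or_eq_zero_of_mul_eq_zero (han 0) ((han 1).mul (han 2)) h hUc with h0 | h12
    · exact hconc _ h0 fun τ => by
        obtain ⟨u, hu, e⟩ := thirdPt_ofComplex_surj 0 τ; exact ⟨u, hu, by rw [e]⟩
    · rcases AnalyticOnNhd.eq_zero_or_eq_zero_of_mul_eq_zero (han 1) (han 2) h12 hUc with h1 | h2
      · exact hconc _ h1 fun τ => by
          obtain ⟨u, hu, e⟩ := thirdPt_ofComplex_surj 1 τ; exact ⟨u, hu, by rw [e]⟩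
      · exact hconc _ h2 fun τ => by
          obtain ⟨u, hu, e⟩ := thirdPt_ofComplex_surj 2 τ; exact ⟨u, hu, by rw [e]⟩

end NormTool

/-! ## 2. `10𝓟² = E₄ + 9E₄(3τ)` -/

section IdentityOne

/-- `F₁ := 10𝓟² − E₄ − 9E₄(3τ)`. [folklore] -/
def idOne (τ : ℍ) : ℂ := 10 * eisThree τ ^ 2 - E₄ τ - 9 * E₄ (mulThree τ)

/-- `E₄(3γτ) = (cτ+d)⁴E₄(3τ)` for `γ ∈ Γ₀(3)`. [folklore] -/
theorem E₄_mulThree_smul (γ : SL(2, ℤ)) (hγ : γ ∈ CongruenceSubgroup.Gamma0 3) (τ : ℍ) :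
    E₄ (mulThree (γ • τ)) = (((γ 1 0 : ℤ) : ℂ) * τ + ((γ 1 1 : ℤ) : ℂ)) ^ 4 * E₄ (mulThree τ) := by
  obtain ⟨k, hk⟩ := (mem_Gamma0_three_iff γ).mp hγ
  rw [mulThree_smul γ ⟨k, hk⟩, levelOne_apply_smul E₄, ModularGroup.denom_apply, sl2zMk_entry_10, sl2zMk_entry_11,
    coe_mulThree, hk, Int.mul_ediv_cancel_left _ (by norm_num : (3 : ℤ) ≠ 0), zpow_ofNat]
  push_cast
  ring

/-- `E₄(γτ) = (cτ+d)⁴E₄(τ)`. [folklore] -/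
theorem E₄_smul' (γ : SL(2, ℤ)) (τ : ℍ) :
    E₄ (γ • τ) = (((γ 1 0 : ℤ) : ℂ) * τ + ((γ 1 1 : ℤ) : ℂ)) ^ 4 * E₄ τ := by
  rw [levelOne_apply_smul E₄, ModularGroup.denom_apply, zpow_ofNat]

/-- `E₄(W₃τ) = 81τ⁴E₄(3τ)` and `E₄(3W₃τ) = τ⁴E₄(τ)`. [folklore] -/
theorem E₄_frickeThree (τ : ℍ) :
    E₄ (frickeThree τ) = 81 * (τ : ℂ) ^ 4 * E₄ (mulThree τ) ∧ E₄ (mulThree (frickeThree τ)) = (τ : ℂ) ^ 4 * E₄ τ := by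
  constructor
  · rw [frickeThree_eq_S_smul, levelOne_apply_smul E₄, ModularGroup.denom_S, coe_mulThree, zpow_ofNat]
    ring
  · rw [mulThree_frickeThree, levelOne_apply_smul E₄, ModularGroup.denom_S, zpow_ofNat]

/-- Covariance of `F₁` under `Γ₀(3)`. [folklore] -/
theorem idOne_smul (γ : SL(2, ℤ)) (hγ : γ ∈ CongruenceSubgroup.Gamma0 3) (τ : ℍ) :
    idOne (γ • τ) = (((γ 1 0 : ℤ) : ℂ) * τ + ((γ 1 1 : ℤ) : ℂ)) ^ 4 * idOne τ := by
  rw [idOne, idOne, eisThree_smul γ hγ, E₄_smul', E₄_mulThree_smul γ hγ]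
  ring

/-- `F₁(W₃τ) = 9τ⁴F₁(τ)`. [folklore] -/
theorem idOne_fricke (τ : ℍ) : idOne (frickeThree τ) = 9 * (τ : ℂ) ^ 4 * idOne τ := by
  obtain ⟨h1, h3⟩ := E₄_frickeThree τ
  rw [idOne, idOne, eisThree_fricke, h1, h3]
  ring

/-- `F₁(τ + 1) = F₁(τ)`. [folklore] -/
theorem idOne_vadd_one (τ : ℍ) : idOne ((1 : ℝ) +ᵥ τ) = idOne τ := by
  have hT : E₄ ((1 : ℝ) +ᵥ τ) = E₄ τ := by
    rw [show (1 : ℝ) +ᵥ τ = ModularGroup.T • τ by rw [UpperHalfPlane.modular_T_smul], levelOne_apply_smul E₄,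
      ModularGroup.denom_apply, zpow_ofNat]
    simp [ModularGroup.T]
  have hT3 : E₄ (mulThree ((1 : ℝ) +ᵥ τ)) = E₄ (mulThree τ) := by
    rw [mulThree_vadd_one]
    have h : ∀ z : ℍ, E₄ ((1 : ℝ) +ᵥ z) = E₄ z := fun z => by
      rw [show (1 : ℝ) +ᵥ z = ModularGroup.T • z by rw [UpperHalfPlane.modular_T_smul], levelOne_apply_smul E₄,
        ModularGroup.denom_apply, zpow_ofNat]
      simp [ModularGroup.T]
    rw [h, h, h]
  rw [idOne, idOne, eisThree_vadd_one, hT, hT3]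

/-- `F₁` is holomorphic. [folklore] -/
theorem mdifferentiable_idOne : MDiff idOne := by
  rw [UpperHalfPlane.mdifferentiable_iff]
  intro w hw
  have hw3 : 0 < (3 * w).im := by simpa using hw
  have hP := differentiableAt_eisThree hw
  have hE : DifferentiableAt ℂ ((E₄ : ℍ → ℂ) ∘ ofComplex) w :=
    (UpperHalfPlane.mdifferentiable_iff.mp (ModularFormClass.holo E₄)).differentiableAt (isOpen_upperHalfPlaneSet.mem_nhds hw)
  have hE3 : DifferentiableAt ℂ (fun u : ℂ => ((E₄ : ℍ → ℂ) ∘ ofComplex) (3 * u)) w :=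
    ((UpperHalfPlane.mdifferentiable_iff.mp (ModularFormClass.holo E₄)).differentiableAt
      (isOpen_upperHalfPlaneSet.mem_nhds hw3)).comp w (differentiableAt_id.const_mul _)
  have h := ((hP.pow 2).const_mul (10 : ℂ)).sub hE |>.sub (hE3.const_mul (9 : ℂ))
  refine (h.congr_of_eventuallyEq ?_).differentiableWithinAt
  filter_upwards [isOpen_upperHalfPlaneSet.mem_nhds hw] with u hu
  simp only [Function.comp_apply, idOne, Pi.sub_apply, Pi.pow_apply, mulThree_ofComplex hu]

/-- `F₁ → 0` at `i∞`. [folklore] -/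
theorem tendsto_idOne : Tendsto idOne atImInfty (𝓝 0) := by
  have h3 : Tendsto (fun τ => E₄ (mulThree τ)) atImInfty (𝓝 1) := tendsto_E4_atImInfty.comp tendsto_mulThree_atImInfty
  have h := ((tendsto_eisThree.pow 2).const_mul (10 : ℂ)).sub tendsto_E4_atImInfty |>.sub (h3.const_mul (9 : ℂ))
  rw [show (10 : ℂ) * 1 ^ 2 - 1 - 9 * 1 = 0 by norm_num] at h
  exact h.congr fun τ => rfl

/-- `F₁ = O(e^{−2π Im τ})`. [folklore] -/
theorem idOne_isBigO : idOne =O[atImInfty] fun τ : ℍ => Real.exp (-2 * π * 1 * τ.im) := by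
  have hper : Function.Periodic (idOne ∘ ofComplex) 1 := by
    intro u
    simp only [Function.comp_apply]
    by_cases hu : 0 < u.im
    · have : ofComplex (u + 1) = ((1 : ℝ) +ᵥ ofComplex u : ℍ) := by
        apply UpperHalfPlane.ext
        rw [UpperHalfPlane.coe_vadd, ofComplex_apply_of_im_pos hu, ofComplex_apply_of_im_pos (by simpa using hu)]
        push_cast; ring
      rw [this, idOne_vadd_one]
    · have hu' : ¬ 0 < (u + 1).im := by simpa using hu
      rw [ofComplex_apply_of_im_nonpos (not_lt.mp hu), ofComplex_apply_of_im_nonpos (not_lt.mp hu')]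
  have h := UpperHalfPlane.IsZeroAtImInfty.exp_decay_atImInfty (h := 1) tendsto_idOne one_pos hper mdifferentiable_idOne
    (tendsto_idOne.isBigO_one ℝ)
  refine h.congr_right fun τ => ?_
  ring_nf

/-- **`10𝓟² = E₄ + 9E₄(3τ)`.** [cite: Zhou2015, Remark 9] -/
theorem ten_eisThree_sq (τ : ℍ) : 10 * eisThree τ ^ 2 = E₄ τ + 9 * E₄ (mulThree τ) := by
  obtain ⟨⟨-, -, e10, e11⟩, ⟨-, -, f10, f11⟩, h1, h2⟩ := gOne_gTwo_facts
  have hg1 : ∀ τ : ℍ, idOne (gOne • τ) = (3 * (τ : ℂ) - 2) ^ 4 * idOne τ := fun τ => by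
    rw [idOne_smul gOne h1, e10, e11]; push_cast; ring
  have hg2 : ∀ τ : ℍ, idOne (gTwo • τ) = (3 * (τ : ℂ) - 1) ^ 4 * idOne τ := fun τ => by
    rw [idOne_smul gTwo h2, f10, f11]; push_cast; ring
  have h := eq_zero_of_eigen_decay (k := 4) (w := 9) mdifferentiable_idOne idOne_vadd_one hg1 hg2 idOne_fricke
    (by norm_num) zero_le_one idOne_isBigO (by norm_num) τ
  rw [idOne] at h
  linear_combination h

end IdentityOne

/-! ## 3. First `q`-coefficients at `i∞` -/

section QLimits

open Literature.NumberTheory.EllipticCurves.ModularForms (periodic_E2_comp_ofComplex tendsto_E2_atImInfty)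

/-- The nome `q = e^{2πiτ}` on `ℍ`. [folklore] -/
def qq (τ : ℍ) : ℂ := cexp (2 * π * Complex.I * τ)

/-- `qq = 𝕢 1`. [folklore] -/
theorem qq_eq (τ : ℍ) : qq τ = Function.Periodic.qParam 1 (τ : ℂ) := by
  rw [qq, Function.Periodic.qParam]; simp

/-- `qq τ ≠ 0`. [folklore] -/
theorem qq_ne_zero (τ : ℍ) : qq τ ≠ 0 := Complex.exp_ne_zero _

/-- `‖qq τ‖ = e^{−2π Im τ}`. [folklore] -/
theorem norm_qq (τ : ℍ) : ‖qq τ‖ = Real.exp (-2 * π * τ.im) := by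
  rw [qq, Complex.norm_exp]; congr 1
  simp

/-- `qq → 0` within `{0}ᶜ` at `i∞`. [folklore] -/
theorem tendsto_qq : Tendsto qq atImInfty (𝓝[≠] 0) := by
  have h : Tendsto qq atImInfty (𝓝 0) := by
    have := UpperHalfPlane.qParam_tendsto_atImInfty one_pos
    exact this.congr fun τ => (qq_eq τ).symm
  exact tendsto_nhdsWithin_iff.mpr ⟨h, Eventually.of_forall fun τ => qq_ne_zero τ⟩

/-- **First-coefficient limit**: for a `1`-periodic holomorphic bounded `f` with `q`-expansion
`∑ cₘ qᵐ`, `(f(τ) − c₀)/q → c₁` at `i∞`. [folklore] -/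
theorem tendsto_sub_div_qq {f : ℍ → ℂ} {c : ℕ → ℂ} (hper : Function.Periodic (f ∘ ofComplex) 1) (hmd : MDiff f)
    (hbd : IsBoundedAtImInfty f) (hsum : ∀ τ : ℍ, HasSum (fun m ↦ c m • Function.Periodic.qParam 1 τ ^ m) (f τ)) :
    Tendsto (fun τ : ℍ => (f τ - c 0) / qq τ) atImInfty (𝓝 (c 1)) := by
  have han : AnalyticAt ℂ (cuspFunction 1 f) 0 := analyticAt_cuspFunction_zero one_pos hper hmd hbd
  have hps := hasFPowerSeriesOnBall_cuspFunction one_pos han hsum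
  have h0 : cuspFunction 1 f 0 = c 0 := by
    have := hps.coeff_zero (fun _ ↦ (0 : ℂ))
    rw [FormalMultilinearSeries.ofScalars_apply_eq] at this
    simpa using this.symm
  have hd : HasDerivAt (cuspFunction 1 f) (c 1) 0 := by
    have := hps.hasFPowerSeriesAt.hasDerivAt
    rwa [FormalMultilinearSeries.ofScalars_apply_eq, one_pow, smul_eq_mul, mul_one] at this
  have hslope := (hasDerivAt_iff_tendsto_slope.mp hd).comp tendsto_qq
  refine hslope.congr fun τ => ?_
  rw [Function.comp_apply, slope_def_field, sub_zero, h0, qq_eq, eq_cuspFunction τ one_ne_zero hper]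

/-- **`(E₂(τ) − 1)/q → −24`.** [folklore] -/
theorem tendsto_E2_sub_one_div_qq : Tendsto (fun τ : ℍ => (E2 τ - 1) / qq τ) atImInfty (𝓝 (-24)) := by
  set c : ℕ → ℂ := fun m ↦ if m = 0 then 1 else -24 * (((ArithmeticFunction.sigma 1 : ArithmeticFunction ℕ) m : ℕ) : ℂ) with hc
  have hsum : ∀ τ : ℍ, HasSum (fun m ↦ c m • Function.Periodic.qParam 1 τ ^ m) (E2 τ) := fun τ ↦ by
    simpa only [hc, Function.Periodic.qParam, Complex.ofReal_one, div_one] using hasSum_qExpansion_E2 (z := τ)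
  have h := tendsto_sub_div_qq periodic_E2_comp_ofComplex E2_mdifferentiable isBoundedAtImInfty_E2 hsum
  have h0 : c 0 = 1 := by simp [hc]
  have h1 : c 1 = -24 := by simp [hc, ArithmeticFunction.sigma_one_apply]
  rw [h0, h1] at h
  exact h

/-- **`(E₄(τ) − 1)/q → 240`.** [folklore] -/
theorem tendsto_E4_sub_one_div_qq : Tendsto (fun τ : ℍ => (E₄ τ - 1) / qq τ) atImInfty (𝓝 240) := by
  set c : ℕ → ℂ := fun m => PowerSeries.coeff m (Literature.Barriers.Schanuel.ramanujanQSeries.map (Int.castRingHom ℂ)) with hc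
  have hsum : ∀ τ : ℍ, HasSum (fun m ↦ c m • Function.Periodic.qParam 1 τ ^ m) (E₄ τ) := fun τ ↦ by
    have := Literature.Barriers.Schanuel.hasSum_E₄ τ
    simpa only [hc, Function.Periodic.qParam, Complex.ofReal_one, div_one, smul_eq_mul] using this
  have h := tendsto_sub_div_qq (SlashInvariantFormClass.periodic_comp_ofComplex E₄ one_mem_strictPeriods_SL)
    (ModularFormClass.holo E₄) (ModularFormClass.bdd_at_infty E₄) hsum
  have h0 : c 0 = 1 := by
    simp [hc, PowerSeries.coeff_map, Literature.Barriers.Schanuel.coeff_ramanujanQSeries]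
  have h1 : c 1 = 240 := by
    simp [hc, PowerSeries.coeff_map, Literature.Barriers.Schanuel.coeff_ramanujanQSeries, ArithmeticFunction.sigma_apply]
  rw [h0, h1] at h
  exact h

/-- `qq (3τ) = qq(τ)³`. [folklore] -/
theorem qq_mulThree (τ : ℍ) : qq (mulThree τ) = qq τ ^ 3 := by
  rw [qq, qq, coe_mulThree, ← Complex.exp_nat_mul]; congr 1; push_cast; ring

/-- `(E₂(3τ) − 1)/q → 0`. [folklore] -/
theorem tendsto_E2_mulThree_sub_one_div_qq : Tendsto (fun τ : ℍ => (E2 (mulThree τ) - 1) / qq τ) atImInfty (𝓝 0) := by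
  have h3 := tendsto_E2_sub_one_div_qq.comp tendsto_mulThree_atImInfty
  have hq : Tendsto (fun τ : ℍ => qq τ ^ 2) atImInfty (𝓝 0) := by
    have := (tendsto_nhdsWithin_iff.mp tendsto_qq).1.pow 2
    rwa [zero_pow two_ne_zero] at this
  have h := h3.mul hq
  rw [mul_zero] at h
  refine h.congr fun τ => ?_
  simp only [Function.comp_apply, qq_mulThree]
  have := qq_ne_zero τ
  field_simp

/-- **`(𝓟(τ) − 1)/q → 12`.** [folklore] -/
theorem tendsto_eisThree_sub_one_div_qq : Tendsto (fun τ : ℍ => (eisThree τ - 1) / qq τ) atImInfty (𝓝 12) := by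
  have h := ((tendsto_E2_mulThree_sub_one_div_qq.const_mul 3).sub tendsto_E2_sub_one_div_qq).div_const 2
  rw [show ((3 : ℂ) * 0 - -24) / 2 = 12 by norm_num] at h
  refine h.congr fun τ => ?_
  simp only [eisThree]
  field_simp
  ring

/-- **`(E₄ − 𝓟²)/q → 216`.** [folklore] -/
theorem tendsto_E4_sub_eisThree_sq_div_qq : Tendsto (fun τ : ℍ => (E₄ τ - eisThree τ ^ 2) / qq τ) atImInfty (𝓝 216) := by
  have hP1 : Tendsto (fun τ : ℍ => eisThree τ + 1) atImInfty (𝓝 2) := by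
    have := tendsto_eisThree.add_const 1; rwa [show (1 : ℂ) + 1 = 2 by norm_num] at this
  have h := tendsto_E4_sub_one_div_qq.sub (tendsto_eisThree_sub_one_div_qq.mul hP1)
  rw [show (240 : ℂ) - 12 * 2 = 216 by norm_num] at h
  refine h.congr fun τ => ?_
  have := qq_ne_zero τ
  field_simp
  ring

/-- **`t/q⁻¹ → 1`**, i.e. `q·t → 1`, in the `qq` notation. [folklore] -/
theorem tendsto_qq_mul_tThree : Tendsto (fun τ : ℍ => qq τ * tThree τ) atImInfty (𝓝 1) := tendsto_q_mul_tThree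

/-- **`t·(E₄ − 𝓟²) → 216`.** [folklore] -/
theorem tendsto_tThree_mul_sub : Tendsto (fun τ : ℍ => tThree τ * (E₄ τ - eisThree τ ^ 2)) atImInfty (𝓝 216) := by
  have h := tendsto_qq_mul_tThree.mul tendsto_E4_sub_eisThree_sq_div_qq
  rw [one_mul] at h
  refine h.congr fun τ => ?_
  have := qq_ne_zero τ
  field_simp

/-- `1/t = O(e^{−2π Im τ})`. [folklore] -/
theorem tThree_inv_isBigO : (fun τ : ℍ => (tThree τ)⁻¹) =O[atImInfty] fun τ : ℍ => Real.exp (-2 * π * τ.im) := by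
  -- `t⁻¹ = q · (q t)⁻¹` with `(q t)⁻¹ → 1`
  have h1 : Tendsto (fun τ : ℍ => (qq τ * tThree τ)⁻¹) atImInfty (𝓝 1) := by
    have := tendsto_qq_mul_tThree.inv₀ one_ne_zero; rwa [inv_one] at this
  have hb := h1.isBigO_one ℝ
  have hq : qq =O[atImInfty] fun τ : ℍ => Real.exp (-2 * π * τ.im) :=
    Asymptotics.IsBigO.of_bound 1 (Eventually.of_forall fun τ => by rw [norm_qq, one_mul, Real.norm_of_nonneg (Real.exp_pos _).le])
  have h := hq.mul hb
  simp only [mul_one] at h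
  refine h.congr_left fun τ => ?_
  have := qq_ne_zero τ
  have := tThree_ne_zero τ
  field_simp

end QLimits

/-! ## 4. `E₄(t + 27) = 𝓟²(t + 243)` and `E₄(3τ)(t + 27) = 𝓟²(t + 3)` -/

section IdentityDelta

/-- `X := E₄(t + 27) − 𝓟²(t + 243)`. [folklore] -/
def XX (τ : ℍ) : ℂ := E₄ τ * (tThree τ + 27) - eisThree τ ^ 2 * (tThree τ + 243)

/-- `Y := E₄(3τ)(t + 27) − 𝓟²(t + 3)`. [folklore] -/
def YY (τ : ℍ) : ℂ := E₄ (mulThree τ) * (tThree τ + 27) - eisThree τ ^ 2 * (tThree τ + 3)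

/-- `X + 9Y = 0` (from `10𝓟² = E₄ + 9E₄(3τ)`). [folklore] -/
theorem XX_add_nine_YY (τ : ℍ) : XX τ + 9 * YY τ = 0 := by
  have h := ten_eisThree_sq τ
  rw [XX, YY]
  linear_combination -(tThree τ + 27) * h

/-! ### The elements `gOne = W₃T⁻¹W₃T⁻¹`, `gTwo = TW₃TW₃` and the invariance of `t` -/

/-- `t(τ − 1) = t(τ)`. [folklore] -/
theorem tThree_vadd_neg_one (τ : ℍ) : tThree ((-1 : ℝ) +ᵥ τ) = tThree τ := by
  rw [← tThree_vadd_one ((-1 : ℝ) +ᵥ τ), vadd_vadd]; norm_num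

/-- `t(W₃τ) = 729/t(τ)`. [folklore] -/
theorem tThree_fricke' (τ : ℍ) : tThree (frickeThree τ) = 729 / tThree τ := by
  rw [eq_div_iff (tThree_ne_zero τ), tThree_fricke]

/-- `gOne • τ = W₃(W₃(τ − 1) − 1)`. [folklore] -/
theorem gOne_smul_eq (τ : ℍ) : gOne • τ = frickeThree ((-1 : ℝ) +ᵥ frickeThree ((-1 : ℝ) +ᵥ τ)) := by
  obtain ⟨⟨e00, e01, e10, e11⟩, -, -, -⟩ := gOne_gTwo_facts
  have hτ1 : (τ : ℂ) - 1 ≠ 0 := by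
    intro h; have := congrArg Complex.im h; simp at this; exact τ.im_pos.ne' this
  have hτ2 : (3 : ℂ) * τ - 2 ≠ 0 := by
    intro h; have := congrArg Complex.im h; simp at this; exact τ.im_pos.ne' this
  have h1 : (((-1 : ℝ) +ᵥ τ : ℍ) : ℂ) = (τ : ℂ) - 1 := by rw [UpperHalfPlane.coe_vadd]; push_cast; ring
  have h2 : ((frickeThree ((-1 : ℝ) +ᵥ τ) : ℍ) : ℂ) = -1 / (3 * ((τ : ℂ) - 1)) := by rw [coe_frickeThree, h1]
  have h3 : (((-1 : ℝ) +ᵥ frickeThree ((-1 : ℝ) +ᵥ τ) : ℍ) : ℂ) = -(3 * (τ : ℂ) - 2) / (3 * ((τ : ℂ) - 1)) := by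
    rw [UpperHalfPlane.coe_vadd, h2]; push_cast; field_simp; ring
  apply UpperHalfPlane.ext
  rw [coe_smul_eq, e00, e01, e10, e11, coe_frickeThree, h3]
  push_cast
  field_simp
  ring

/-- `gTwo • τ = W₃(W₃τ + 1) + 1`. [folklore] -/
theorem gTwo_smul_eq (τ : ℍ) : gTwo • τ = (1 : ℝ) +ᵥ frickeThree ((1 : ℝ) +ᵥ frickeThree τ) := by
  obtain ⟨-, ⟨e00, e01, e10, e11⟩, -, -⟩ := gOne_gTwo_facts
  have hτ0 : (τ : ℂ) ≠ 0 := τ.ne_zero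
  have hτ1 : (3 : ℂ) * τ - 1 ≠ 0 := by
    intro h; have := congrArg Complex.im h; simp at this; exact τ.im_pos.ne' this
  have h1 : (((1 : ℝ) +ᵥ frickeThree τ : ℍ) : ℂ) = (3 * (τ : ℂ) - 1) / (3 * τ) := by
    rw [UpperHalfPlane.coe_vadd, coe_frickeThree]; push_cast; field_simp; ring
  have h2 : ((frickeThree ((1 : ℝ) +ᵥ frickeThree τ) : ℍ) : ℂ) = -(τ : ℂ) / (3 * τ - 1) := by
    rw [coe_frickeThree, h1]; field_simp
  have hτ1' : (3 : ℂ) * τ + -1 ≠ 0 := by rw [show (3 : ℂ) * τ + -1 = 3 * τ - 1 by ring]; exact hτ1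
  apply UpperHalfPlane.ext
  rw [coe_smul_eq, e00, e01, e10, e11, UpperHalfPlane.coe_vadd, h2]
  push_cast
  rw [show (3 : ℂ) * τ + -1 = 3 * τ - 1 by ring, div_eq_iff hτ1, add_mul, div_mul_cancel₀ _ hτ1]
  ring

/-- **`t` is invariant under `gOne` and `gTwo`.** [folklore] -/
theorem tThree_gOne_gTwo (τ : ℍ) : tThree (gOne • τ) = tThree τ ∧ tThree (gTwo • τ) = tThree τ := by
  have ht := tThree_ne_zero τ
  constructor
  · rw [gOne_smul_eq, tThree_fricke', tThree_vadd_neg_one, tThree_fricke', tThree_vadd_neg_one]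
    field_simp
  · rw [gTwo_smul_eq, tThree_vadd_one, tThree_fricke', tThree_vadd_one, tThree_fricke']
    field_simp

/-! ### Transformation laws of `X` and `Φ = X²/t` -/

/-- Covariance of `X` under `gOne`, `gTwo` (weight `4`) and `T`. [folklore] -/
theorem XX_laws (τ : ℍ) : XX (gOne • τ) = (3 * (τ : ℂ) - 2) ^ 4 * XX τ ∧ XX (gTwo • τ) = (3 * (τ : ℂ) - 1) ^ 4 * XX τ ∧
    XX ((1 : ℝ) +ᵥ τ) = XX τ := by
  obtain ⟨⟨-, -, e10, e11⟩, ⟨-, -, f10, f11⟩, h1, h2⟩ := gOne_gTwo_facts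
  obtain ⟨t1, t2⟩ := tThree_gOne_gTwo τ
  refine ⟨?_, ?_, ?_⟩
  · rw [XX, XX, E₄_smul', eisThree_smul gOne h1, t1, e10, e11]; push_cast; ring
  · rw [XX, XX, E₄_smul', eisThree_smul gTwo h2, t2, f10, f11]; push_cast; ring
  · have hT : E₄ ((1 : ℝ) +ᵥ τ) = E₄ τ := by
      rw [show (1 : ℝ) +ᵥ τ = ModularGroup.T • τ by rw [UpperHalfPlane.modular_T_smul], levelOne_apply_smul E₄,
        ModularGroup.denom_apply, zpow_ofNat]
      simp [ModularGroup.T]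
    rw [XX, XX, hT, eisThree_vadd_one, tThree_vadd_one]

/-- **`X(W₃τ) = −(243τ⁴/t)·X(τ)`** (through `Y = −X/9`). [folklore] -/
theorem XX_fricke (τ : ℍ) : XX (frickeThree τ) = -(243 * (τ : ℂ) ^ 4 / tThree τ) * XX τ := by
  obtain ⟨hE1, -⟩ := E₄_frickeThree τ
  have hY : YY τ = -(XX τ) / 9 := by have := XX_add_nine_YY τ; linear_combination this / 9
  have ht := tThree_ne_zero τ
  have key : XX (frickeThree τ) = 2187 * (τ : ℂ) ^ 4 / tThree τ * YY τ := by
    rw [XX, YY, hE1, eisThree_fricke, tThree_fricke']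
    field_simp
    ring
  rw [key, hY]
  field_simp
  ring

/-- `Φ := X²/t`. [folklore] -/
def Phi (τ : ℍ) : ℂ := XX τ ^ 2 / tThree τ

/-- Laws of `Φ`: weight `8` under `gOne`, `gTwo`, period `1`, `Φ(W₃τ) = 81τ⁸Φ(τ)`. [folklore] -/
theorem Phi_laws (τ : ℍ) : Phi (gOne • τ) = (3 * (τ : ℂ) - 2) ^ 8 * Phi τ ∧ Phi (gTwo • τ) = (3 * (τ : ℂ) - 1) ^ 8 * Phi τ ∧
    Phi ((1 : ℝ) +ᵥ τ) = Phi τ ∧ Phi (frickeThree τ) = 81 * (τ : ℂ) ^ 8 * Phi τ := by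
  obtain ⟨x1, x2, xT⟩ := XX_laws τ
  obtain ⟨t1, t2⟩ := tThree_gOne_gTwo τ
  have ht := tThree_ne_zero τ
  refine ⟨?_, ?_, ?_, ?_⟩
  · rw [Phi, Phi, x1, t1]; ring
  · rw [Phi, Phi, x2, t2]; ring
  · rw [Phi, Phi, xT, tThree_vadd_one]
  · rw [Phi, Phi, XX_fricke, tThree_fricke']
    field_simp
    ring

/-! ### Holomorphy and decay -/

/-- `t` is holomorphic. [folklore] -/
theorem mdifferentiable_tThree : MDiff tThree :=
  UpperHalfPlane.mdifferentiable_iff.mpr fun _ hw => (hasDerivAt_tThree_ofComplex hw).differentiableAt.differentiableWithinAt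

/-- `X` is holomorphic. [folklore] -/
theorem mdifferentiable_XX : MDiff XX := by
  rw [UpperHalfPlane.mdifferentiable_iff]
  intro w hw
  have hP := differentiableAt_eisThree hw
  have hE : DifferentiableAt ℂ ((E₄ : ℍ → ℂ) ∘ ofComplex) w :=
    (UpperHalfPlane.mdifferentiable_iff.mp (ModularFormClass.holo E₄)).differentiableAt (isOpen_upperHalfPlaneSet.mem_nhds hw)
  have ht : DifferentiableAt ℂ (tThree ∘ ofComplex) w := (hasDerivAt_tThree_ofComplex hw).differentiableAt
  have h := (hE.mul (ht.add_const 27)).sub ((hP.pow 2).mul (ht.add_const 243))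
  refine (h.congr_of_eventuallyEq ?_).differentiableWithinAt
  filter_upwards with u
  simp only [Function.comp_apply, XX, Pi.sub_apply, Pi.mul_apply, Pi.pow_apply]

/-- `Φ` is holomorphic. [folklore] -/
theorem mdifferentiable_Phi : MDiff Phi := by
  rw [UpperHalfPlane.mdifferentiable_iff]
  intro w hw
  have hX : DifferentiableAt ℂ (XX ∘ ofComplex) w :=
    (UpperHalfPlane.mdifferentiable_iff.mp mdifferentiable_XX).differentiableAt (isOpen_upperHalfPlaneSet.mem_nhds hw)
  have ht : DifferentiableAt ℂ (tThree ∘ ofComplex) w := (hasDerivAt_tThree_ofComplex hw).differentiableAt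
  have h := (hX.pow 2).div ht (tThree_ne_zero _)
  refine (h.congr_of_eventuallyEq ?_).differentiableWithinAt
  filter_upwards with u
  simp only [Function.comp_apply, Phi, Pi.div_apply, Pi.pow_apply]

/-- **`X → 0` at `i∞`** (`t(E₄ − 𝓟²) → 216`, `27E₄ − 243𝓟² → −216`). [folklore] -/
theorem tendsto_XX : Tendsto XX atImInfty (𝓝 0) := by
  have h := (tendsto_tThree_mul_sub.add (tendsto_E4_atImInfty.const_mul 27)).sub ((tendsto_eisThree.pow 2).const_mul 243)
  rw [show (216 : ℂ) + 27 * 1 - 243 * 1 ^ 2 = 0 by norm_num] at h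
  refine h.congr fun τ => ?_
  simp only [XX]; ring

/-- `X ∘ ofComplex` is `1`-periodic. [folklore] -/
theorem periodic_XX : Function.Periodic (XX ∘ ofComplex) 1 := by
  intro u
  simp only [Function.comp_apply]
  by_cases hu : 0 < u.im
  · have : ofComplex (u + 1) = ((1 : ℝ) +ᵥ ofComplex u : ℍ) := by
      apply UpperHalfPlane.ext
      rw [UpperHalfPlane.coe_vadd, ofComplex_apply_of_im_pos hu, ofComplex_apply_of_im_pos (by simpa using hu)]
      push_cast; ring
    rw [this, (XX_laws _).2.2]
  · have hu' : ¬ 0 < (u + 1).im := by simpa using hu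
    rw [ofComplex_apply_of_im_nonpos (not_lt.mp hu), ofComplex_apply_of_im_nonpos (not_lt.mp hu')]

/-- `X = O(e^{−2π Im τ})`. [folklore] -/
theorem XX_isBigO : XX =O[atImInfty] fun τ : ℍ => Real.exp (-2 * π * τ.im) := by
  have h := UpperHalfPlane.IsZeroAtImInfty.exp_decay_atImInfty (h := 1) tendsto_XX one_pos periodic_XX mdifferentiable_XX
    (tendsto_XX.isBigO_one ℝ)
  refine h.congr_right fun τ => ?_
  ring_nf

/-- **`Φ = O(e^{−6π Im τ})`.** [folklore] -/
theorem Phi_isBigO : Phi =O[atImInfty] fun τ : ℍ => Real.exp (-2 * π * 3 * τ.im) := by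
  have h := (XX_isBigO.mul XX_isBigO).mul tThree_inv_isBigO
  refine (h.congr_left fun τ => ?_).congr_right fun τ => ?_
  · simp only [Phi]; rw [sq, div_eq_mul_inv]
  · rw [← Real.exp_add, ← Real.exp_add]; ring_nf

/-- **`Φ = 0`** by the vanishing criterion (`k = 8`, `w = 81`, decay `e^{−6π Im}`, `⌊32/12⌋ = 2 < 6`). [folklore] -/
theorem Phi_eq_zero (τ : ℍ) : Phi τ = 0 :=
  eq_zero_of_eigen_decay (k := 8) (w := 81) mdifferentiable_Phi (fun τ => (Phi_laws τ).2.2.1)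
    (fun τ => (Phi_laws τ).1) (fun τ => (Phi_laws τ).2.1) (fun τ => (Phi_laws τ).2.2.2) (by norm_num) (by norm_num) Phi_isBigO
    (by norm_num) τ

/-- **`X = 0`, i.e. `E₄·(t + 27) = 𝓟²(t + 243)`.** [cite: Zhou2015, Remark 9] -/
theorem E₄_mul_tThree_add (τ : ℍ) : E₄ τ * (tThree τ + 27) = eisThree τ ^ 2 * (tThree τ + 243) := by
  have h := Phi_eq_zero τ
  rw [Phi, div_eq_zero_iff, or_iff_left (tThree_ne_zero τ)] at h
  have hX : XX τ = 0 := pow_eq_zero_iff two_ne_zero |>.mp h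
  rw [XX] at hX
  linear_combination hX

/-- **`Y = 0`, i.e. `E₄(3τ)·(t + 27) = 𝓟²(t + 3)`.** [cite: Zhou2015, Remark 9] -/
theorem E₄_mulThree_mul_tThree_add (τ : ℍ) : E₄ (mulThree τ) * (tThree τ + 27) = eisThree τ ^ 2 * (tThree τ + 3) := by
  have hX : XX τ = 0 := by rw [XX]; linear_combination E₄_mul_tThree_add τ
  have h := XX_add_nine_YY τ
  rw [hX, zero_add, mul_eq_zero, or_iff_right (by norm_num : (9 : ℂ) ≠ 0), YY] at h
  linear_combination h

end IdentityDelta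

/-! ## 5. `𝓟³·t = Δ₃·(t + 27)²` by a Wronskian computation -/

section IdentityAlpha

/-- **`(Δ₃ ∘ ofComplex)' = Δ₃ · (πi/2)(E₂ + 3E₂(3·))`** (logarithmic derivative of `η`). [folklore] -/
theorem hasDerivAt_deltaThree_ofComplex {w : ℂ} (hw : 0 < w.im) :
    HasDerivAt (deltaThree ∘ ofComplex)
      ((deltaThree ∘ ofComplex) w * (π * Complex.I / 2 * (FE2 w + 3 * FE2 (3 * w)))) w := by
  have hw3 : 0 < (3 * w).im := by simpa using hw
  have h1 := hasDerivAt_eta hw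
  have hlin : HasDerivAt (fun u : ℂ => 3 * u) 3 w := ((hasDerivAt_id' w).const_mul (3 : ℂ)).congr_deriv (mul_one _)
  have h3 : HasDerivAt (fun u : ℂ => η (3 * u)) (π * Complex.I / 12 * E2 (ofComplex (3 * w)) * η (3 * w) * 3) w :=
    (hasDerivAt_eta hw3).comp w hlin
  have hprod := (h1.mul h3).pow 6
  have hev : (deltaThree ∘ ofComplex) =ᶠ[𝓝 w] fun u => (η u * η (3 * u)) ^ 6 := by
    filter_upwards [isOpen_upperHalfPlaneSet.mem_nhds hw] with u hu
    simp only [Function.comp_apply, deltaThree, coe_mulThree, ofComplex_apply_of_im_pos hu]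
  have hfinal := hprod.congr_of_eventuallyEq hev
  have hD : (deltaThree ∘ ofComplex) w = (η w * η (3 * w)) ^ 6 := by
    rw [Function.comp_apply, deltaThree, coe_mulThree, ofComplex_apply_of_im_pos hw]
  rw [hD, FE2, FE2]
  refine hfinal.congr_deriv ?_
  simp only [Function.comp_apply, Pi.mul_apply]
  norm_num
  ring

/-- `A := 𝓟³ t` and `B := Δ₃ (t + 27)²` through `ofComplex`. [folklore] -/
def AA (u : ℂ) : ℂ := (eisThree ∘ ofComplex) u ^ 3 * (tThree ∘ ofComplex) u

/-- `B := Δ₃ (t + 27)²` through `ofComplex`. [folklore] -/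
def BB (u : ℂ) : ℂ := (deltaThree ∘ ofComplex) u * ((tThree ∘ ofComplex) u + 27) ^ 2

/-- Derivative of `A`. [folklore] -/
theorem hasDerivAt_AA {w : ℂ} (hw : 0 < w.im) :
    HasDerivAt AA (3 * (eisThree ∘ ofComplex) w ^ 2 * PE1 w * (tThree ∘ ofComplex) w +
      (eisThree ∘ ofComplex) w ^ 3 * (-(2 * π * Complex.I) * (eisThree ∘ ofComplex) w * (tThree ∘ ofComplex) w)) w := by
  have h := ((hasDerivAt_eisThree_ofComplex hw).pow 3).mul (hasDerivAt_tThree_ofComplex hw)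
  refine (h.congr_of_eventuallyEq (Eventually.of_forall fun u => rfl)).congr_deriv ?_
  norm_num

/-- Derivative of `B`. [folklore] -/
theorem hasDerivAt_BB {w : ℂ} (hw : 0 < w.im) :
    HasDerivAt BB ((deltaThree ∘ ofComplex) w * (π * Complex.I / 2 * (FE2 w + 3 * FE2 (3 * w))) * ((tThree ∘ ofComplex) w + 27) ^ 2 +
      (deltaThree ∘ ofComplex) w * (2 * ((tThree ∘ ofComplex) w + 27) *
        (-(2 * π * Complex.I) * (eisThree ∘ ofComplex) w * (tThree ∘ ofComplex) w))) w := by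
  have h := (hasDerivAt_deltaThree_ofComplex hw).mul (((hasDerivAt_tThree_ofComplex hw).add_const 27).pow 2)
  refine (h.congr_of_eventuallyEq (Eventually.of_forall fun u => rfl)).congr_deriv ?_
  norm_num

/-- **The Wronskian of `A` and `B` vanishes**: `A·B' − B·A' = −(2πi/4)·𝓟²tΔ₃(t+27)·X = 0`. [folklore] -/
theorem wronskian_eq_zero {w : ℂ} (hw : 0 < w.im) :
    AA w * ((deltaThree ∘ ofComplex) w * (π * Complex.I / 2 * (FE2 w + 3 * FE2 (3 * w))) * ((tThree ∘ ofComplex) w + 27) ^ 2 +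
      (deltaThree ∘ ofComplex) w * (2 * ((tThree ∘ ofComplex) w + 27) *
        (-(2 * π * Complex.I) * (eisThree ∘ ofComplex) w * (tThree ∘ ofComplex) w))) -
    BB w * (3 * (eisThree ∘ ofComplex) w ^ 2 * PE1 w * (tThree ∘ ofComplex) w +
      (eisThree ∘ ofComplex) w ^ 3 * (-(2 * π * Complex.I) * (eisThree ∘ ofComplex) w * (tThree ∘ ofComplex) w)) = 0 := by
  have hw3 : 0 < (3 * w).im := by simpa using hw
  have eo : mulThree (ofComplex w) = ofComplex (3 * w) := mulThree_ofComplex hw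
  -- the three relations, in applied form
  have hP : eisThree (ofComplex w) = (3 * E2 (ofComplex (3 * w)) - E2 (ofComplex w)) / 2 := by
    rw [eisThree, eo]
  have hI1 : 10 * eisThree (ofComplex w) ^ 2 = E₄ (ofComplex w) + 9 * E₄ (ofComplex (3 * w)) := by
    rw [← eo]; exact ten_eisThree_sq (ofComplex w)
  have hδ : E₄ (ofComplex w) * (tThree (ofComplex w) + 27) = eisThree (ofComplex w) ^ 2 * (tThree (ofComplex w) + 243) :=
    E₄_mul_tThree_add (ofComplex w)
  simp only [AA, BB, PE1, FE2', FE2, GE4, Function.comp_apply]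
  set P := eisThree (ofComplex w)
  set T := tThree (ofComplex w)
  set Dl := deltaThree (ofComplex w)
  set F1 := E2 (ofComplex w)
  set F3 := E2 (ofComplex (3 * w))
  set G1 := E₄ (ofComplex w)
  set G3 := E₄ (ofComplex (3 * w))
  set c : ℂ := 2 * π * Complex.I with hc
  rw [show (π : ℂ) * Complex.I / 2 = c / 4 by rw [hc]; ring]
  linear_combination (-(c / 8) * P ^ 2 * T * (Dl * (T + 27) ^ 2)) * hI1 +
    ((c / 4) * P ^ 2 * T * (Dl * (T + 27) ^ 2) * (F1 + 3 * F3 - 2 * P) + P ^ 3 * T * Dl * (c / 2) * (T + 27) ^ 2) * hP -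
    ((c / 4) * P ^ 2 * T * Dl * (T + 27)) * hδ

/-- **`Δ₃·t → 1`** at `i∞` (`Δ₃t = η¹⁸/η₃⁶ = (P¹⁸/P₃⁶)` exactly, the nomes cancel). [folklore] -/
theorem tendsto_deltaThree_mul_tThree : Tendsto (fun τ : ℍ => deltaThree τ * tThree τ) atImInfty (𝓝 1) := by
  have h1 : Tendsto (fun τ : ℍ => etaProd (τ : ℂ)) atImInfty (𝓝 1) := tendsto_eta_tprod_atImInfty
  have h3 : Tendsto (fun τ : ℍ => etaProd ((mulThree τ : ℍ) : ℂ)) atImInfty (𝓝 1) :=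
    tendsto_eta_tprod_atImInfty.comp tendsto_mulThree_atImInfty
  have h := (h1.pow 18).div (h3.pow 6) (by norm_num)
  rw [one_pow, one_pow, div_one] at h
  refine h.congr fun τ => ?_
  have hη3 : η ((mulThree τ : ℍ) : ℂ) ≠ 0 := ModularForm.eta_ne_zero (mulThree τ).2
  have hq1 : Function.Periodic.qParam 24 (τ : ℂ) ≠ 0 := by rw [Function.Periodic.qParam]; exact Complex.exp_ne_zero _
  have hq3 : Function.Periodic.qParam 24 ((mulThree τ : ℍ) : ℂ) ≠ 0 := by rw [Function.Periodic.qParam]; exact Complex.exp_ne_zero _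
  have hP3 : etaProd ((mulThree τ : ℍ) : ℂ) ≠ 0 := ModularForm.eta_tprod_ne_zero (mulThree τ).2
  -- `𝕢₂₄(τ)¹⁸ = 𝕢₂₄(3τ)⁶`
  have hqq : Function.Periodic.qParam 24 (τ : ℂ) ^ 18 = Function.Periodic.qParam 24 ((mulThree τ : ℍ) : ℂ) ^ 6 := by
    rw [Function.Periodic.qParam, Function.Periodic.qParam, ← Complex.exp_nat_mul, ← Complex.exp_nat_mul, coe_mulThree]
    congr 1; push_cast; ring
  simp only [Pi.div_apply]
  rw [deltaThree, tThree, eta_eq_qParam_mul_etaProd, eta_eq_qParam_mul_etaProd]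
  rw [eta_eq_qParam_mul_etaProd] at hη3
  field_simp
  linear_combination (-(etaProd (τ : ℂ)) ^ 18) * hqq

/-- `A/B → 1` at `i∞`. [folklore] -/
theorem tendsto_AA_div_BB : Tendsto (fun τ : ℍ => AA τ / BB τ) atImInfty (𝓝 1) := by
  -- `A/B = 𝓟³ / ((Δ₃ t)(1 + 27 t⁻¹)²)`
  have hinv : Tendsto (fun τ : ℍ => (tThree τ)⁻¹) atImInfty (𝓝 0) := by
    have hlin : Tendsto (fun τ : ℍ => -2 * π * τ.im) atImInfty atBot := by
      have hc : (0 : ℝ) < 2 * π := by positivity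
      have him : Tendsto UpperHalfPlane.im atImInfty atTop := tendsto_comap
      exact Filter.Tendsto.const_mul_atTop_of_neg (show -2 * π < 0 by linarith) him
    exact tThree_inv_isBigO.trans_tendsto (Real.tendsto_exp_atBot.comp hlin)
  have hden : Tendsto (fun τ : ℍ => deltaThree τ * tThree τ * (1 + 27 * (tThree τ)⁻¹) ^ 2) atImInfty (𝓝 1) := by
    have := tendsto_deltaThree_mul_tThree.mul ((hinv.const_mul 27 |>.const_add 1).pow 2)
    simpa using this
  have h := (tendsto_eisThree.pow 3).div hden one_ne_zero
  rw [one_pow, div_one] at h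
  refine h.congr fun τ => ?_
  have ht := tThree_ne_zero τ
  simp only [AA, BB, Function.comp_apply, ofComplex_apply, Pi.div_apply]
  field_simp

/-- **`t + 27 ≠ 0` high in the cusp**: there is `Y₀` with `B ≠ 0` for `Im > Y₀`. [folklore] -/
theorem exists_height_BB_ne_zero : ∃ Y₀ : ℝ, 0 < Y₀ ∧ ∀ u : ℂ, Y₀ < u.im → BB u ≠ 0 := by
  -- eventually `‖q t − 1‖ < 1/2` and `‖q‖ < 1/54`, so `‖t‖ > 27`
  have h1 : ∀ᶠ τ : ℍ in atImInfty, ‖qq τ * tThree τ - 1‖ < 1 / 2 := by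
    have := tendsto_qq_mul_tThree
    rw [tendsto_iff_norm_sub_tendsto_zero] at this
    exact this.eventually (gt_mem_nhds (by norm_num))
  have h2 : ∀ᶠ τ : ℍ in atImInfty, ‖qq τ‖ < 1 / 54 := by
    have := (tendsto_nhdsWithin_iff.mp tendsto_qq).1
    rw [tendsto_iff_norm_sub_tendsto_zero] at this
    simpa using this.eventually (gt_mem_nhds (by norm_num : (0:ℝ) < 1 / 54))
  obtain ⟨A, hA⟩ := (UpperHalfPlane.atImInfty_mem _).mp (h1.and h2)
  refine ⟨max A 1, lt_max_of_lt_right one_pos, fun u hu hB => ?_⟩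
  have hu0 : 0 < u.im := lt_trans (lt_max_of_lt_right one_pos) hu
  have huA : A ≤ (ofComplex u).im := by
    rw [← UpperHalfPlane.coe_im, ofComplex_apply_of_im_pos hu0]; exact ((le_max_left _ _).trans hu.le)
  obtain ⟨hn1, hn2⟩ := hA (ofComplex u) huA
  set τ := ofComplex u
  have hΔ : deltaThree τ ≠ 0 := deltaThree_ne_zero τ
  rw [BB, Function.comp_apply, Function.comp_apply, mul_eq_zero, or_iff_right hΔ, pow_eq_zero_iff two_ne_zero] at hB
  have ht : tThree τ = -27 := by linear_combination hB
  rw [ht] at hn1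
  -- `‖−27 q − 1‖ ≥ 1 − 27‖q‖ > 1/2`
  have hrev : ‖qq τ * (-27) - 1‖ = ‖1 - qq τ * (-27)‖ := norm_sub_rev _ _
  have h := norm_sub_norm_le (1 : ℂ) (qq τ * (-27))
  have h27 : ‖(27 : ℂ)‖ = 27 := by simp
  rw [norm_one, norm_mul, norm_neg, h27] at h
  linarith

/-- **`𝓟³·t = Δ₃·(t + 27)²`.** [cite: Zhou2015, Remark 9] -/
theorem eisThree_cube_mul_tThree (τ : ℍ) : eisThree τ ^ 3 * tThree τ = deltaThree τ * (tThree τ + 27) ^ 2 := by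
  obtain ⟨Y₀, hY₀, hB⟩ := exists_height_BB_ne_zero
  set V : Set ℂ := {u : ℂ | Y₀ < u.im} with hV
  have hVo : IsOpen V := Complex.continuous_im.isOpen_preimage _ isOpen_Ioi
  have hVc : IsPreconnected V := (convex_halfSpace_im_gt Y₀).isPreconnected
  have hVim : ∀ u ∈ V, 0 < u.im := fun u hu => lt_trans hY₀ hu
  -- `R := A/B` is locally constant on `V`
  set R : ℂ → ℂ := fun u => AA u / BB u with hR
  have hRd : ∀ u ∈ V, HasDerivAt R 0 u := by
    intro u hu
    have hu0 := hVim u hu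
    have h := (hasDerivAt_AA hu0).div (hasDerivAt_BB hu0) (hB u hu)
    refine h.congr_deriv ?_
    rw [div_eq_zero_iff]; left
    linear_combination -(wronskian_eq_zero hu0)
  have hRdiff : DifferentiableOn ℂ R V := fun u hu => (hRd u hu).differentiableAt.differentiableWithinAt
  obtain ⟨c, hc⟩ := hVo.exists_is_const_of_deriv_eq_zero hVc hRdiff fun u hu => (hRd u hu).deriv
  -- the constant is `1`
  have hc1 : c = 1 := by
    have hev : ∀ᶠ τ : ℍ in atImInfty, AA τ / BB τ = c := by
      rw [Filter.eventually_iff, UpperHalfPlane.atImInfty_mem]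
      refine ⟨Y₀ + 1, fun τ hτ => hc (τ : ℂ) ?_⟩
      show Y₀ < (τ : ℂ).im
      rw [UpperHalfPlane.coe_im]; linarith
    have h1 : Tendsto (fun τ : ℍ => AA τ / BB τ) atImInfty (𝓝 c) := tendsto_const_nhds.congr' (hev.mono fun τ h => h.symm)
    exact tendsto_nhds_unique h1 tendsto_AA_div_BB
  -- `A = B` on `V`, then everywhere by the identity theorem
  set U : Set ℂ := {u : ℂ | 0 < u.im}
  have hUo : IsOpen U := isOpen_upperHalfPlaneSet
  have hUc : IsPreconnected U := (convex_halfSpace_im_gt 0).isPreconnected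
  have hAan : AnalyticOnNhd ℂ AA U := by
    apply DifferentiableOn.analyticOnNhd _ hUo
    intro u hu; exact (hasDerivAt_AA hu).differentiableAt.differentiableWithinAt
  have hBan : AnalyticOnNhd ℂ BB U := by
    apply DifferentiableOn.analyticOnNhd _ hUo
    intro u hu; exact (hasDerivAt_BB hu).differentiableAt.differentiableWithinAt
  set z₀ : ℂ := (Y₀ + 1 : ℝ) * Complex.I with hz₀
  have hz₀im : z₀.im = Y₀ + 1 := by simp [hz₀]
  have hz₀U : z₀ ∈ U := by show 0 < z₀.im; rw [hz₀im]; linarith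
  have hloc : (AA - BB) =ᶠ[𝓝 z₀] 0 := by
    have hVn : V ∈ 𝓝 z₀ := hVo.mem_nhds (by show Y₀ < z₀.im; rw [hz₀im]; linarith)
    filter_upwards [hVn] with u hu
    have h := hc u hu
    rw [hc1] at h
    have hBu := hB u hu
    simp only [Pi.sub_apply, Pi.zero_apply]
    rw [div_eq_one_iff_eq hBu] at h
    rw [h, sub_self]
  have hzero := (hAan.sub hBan).eqOn_zero_of_preconnected_of_eventuallyEq_zero hUc hz₀U hloc
  have h := hzero (x := (τ : ℂ)) τ.im_pos
  simp only [Pi.sub_apply, Pi.zero_apply, sub_eq_zero, AA, BB, Function.comp_apply, ofComplex_apply] at h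
  exact h

end IdentityAlpha

end Literature.NumberTheory.ModularForms

end
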